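import Literature.AlgebraicGeometry.HodgeTheory.TwistHodgePullback
import Literature.AlgebraicGeometry.HodgeTheory.TwistJetPushforwardIso
import HarnessLib

/-!
# The twisted jet modules `Pʲ(E)` along the pull-back by a morphism of `S`-schemes («jets commute with base change»)

Layer `Literature/AlgebraicGeometry/HodgeTheory`; the PULL-BACK companion of `TwistJetPushforwardIso.lean` §§«twisted jet module»,
«Atiyah steps» (there: along an ISOMORPHISM `e`, for `e_*`), and the sequel of `TwistHodgePullback.lean` (the comparison
`α_j = twistHodgePullbackHom g hE j : g^*(E ⊗ Ωʲ_{X₁}) ⟶ g^*E ⊗ Ωʲ_{X₀}` and its naturality). For ANY morphism `g : X₀ ⟶ X₁` of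
`S`-schemes (`g^* = Scheme.Modules.pullback g.left`, `g_* = Scheme.Modules.pushforward g.left`) and a finite locally free
`𝒪_{X₁}`-module `E`, with `Pʲ(E) = twistJetModule E j` the `Ωʲ`-twisted jet module of `SemiregularityHigherSigma.lean` (sections
`(φ, ψ)`, `φ ∈ E ⊗ Ωʲ`, `ψ ∈ E ⊗ Ωʲ⁺¹`, TWISTED action `a • (φ, ψ) = (aφ, aψ + da ∧ φ)`):

* §1 `twistHodgePullbackTransposeHom g hE j : E ⊗ Ωʲ ⟶ g_*(g^*E ⊗ Ωʲ)` (`β_j`, the transpose of `α_j`) with its sections formula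
  `β_j(φ) = ((g^*E)^∨ ≅ g^*(E^∨)) ≫ g^*φ ≫ dg` (`twistHodgePullbackTransposeHom_app`);
* §2 **the twisting term along `g`**: `β_{j+1}(da ∧ φ) = d(g♯a) ∧ β_j(φ)` (`twistHodgePullbackTransposeHom_app_wedgeD`) — from the
  tree's `wedge_evalAt_dSection_comap` (the wedge and `d` commute with pull-back of forms, any `g`) through
  `pullbackHomOver_wedge_evalAt_comp_pullbackForms`;
* §3 hence the sections map `(φ, ψ) ↦ (β_j φ, β_{j+1} ψ)` is `𝒪_{X₁}`-LINEAR for the twisted structures: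
  `twistJetPullbackTransposeHom g hE j : Pʲ(E) ⟶ g_* Pʲ(g^*E)`, and its transpose
  **`twistJetPullbackHom g hE j : g^* Pʲ(E) ⟶ Pʲ(g^*E)`** — THE BASE-CHANGE MORPHISM OF THE TWISTED JET MODULES, for any `g`;
* §4 compatibility with `ι : E ⊗ Ωʲ⁺¹ → Pʲ` and `π : Pʲ → E ⊗ Ωʲ` (`pullback_map_twistJetι_comp_twistJetPullbackHom`,
  `pullback_map_twistJetπ_comp_twistHodgePullbackHom`), i.e. a morphism of the twisted Atiyah sequences
  `g^*(0 → E⊗Ωʲ⁺¹ → Pʲ(E) → E⊗Ωʲ → 0) ⟶ (0 → g^*E⊗Ωʲ⁺¹ → Pʲ(g^*E) → g^*E⊗Ωʲ → 0)` (`twistJetShortComplexPullbackHom`);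
* §5 `ι : E → E ⊗ Ω⁰` along `g^*`: `g^*(ι_E) ≫ α_0 = ι_{g^*E}` (`pullback_map_toTwistHodgeZero_comp_twistHodgePullbackHom`; on
  `0`-forms the pull-back of forms is `g♯`, `comap_app_hodgeSheafZeroIso_inv_app`).

Everything is a construction or a proved lemma; no named facts, no new notion (only comparison morphisms between existing objects).
What is NOT here: that `twistJetPullbackHom` is an isomorphism for `g` étale; the chain-level and derived-category consequences
(`g^{**}(At_j(K•)) · [Q α_{j+1}•] = [Q α_j•] · At_j(g^*•K•)` for the EXACT functor `g^*` of a flat `g`) — those sit over the venture's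
`complexAtiyahStep` on the Summits side. Motivation: step (Q4) of the typing plan of the library item (L2) `SigmaPullbackCompat`
(crux stmt-HodgeConjecture-26512, support line «sigma-descent-along-q»); nothing of that crux is asserted here.

## References

* R.-O. Buchweitz, H. Flenner, *A semiregularity map for modules and applications to deformations*, Compositio Math. 137 (2003), §3
  (the Atiyah class of a module and of a complex; its functoriality under base change). [BuchweitzFlenner2003]
* M. F. Atiyah, *Complex analytic connections in fibre bundles*, Trans. AMS 85 (1957), §4 Prop. 6–7 (functoriality of the jet
  extension). [Atiyah1957]
* R. Hartshorne, *Algebraic Geometry*, GTM 52 (1977), II Prop. 8.11 (`dg` on differentials), II Ex. 5.1 (a), (b), II §5 p. 110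
  (`f^* ⊣ f_*`). [Hartshorne1977]
* U. Görtz, T. Wedhorn, *Algebraic Geometry I*, 2nd ed. (2020), (7.8.3) and Exercise 7.20 (a). [GortzWedhorn2020]
-/

noncomputable section

-- `TopCat.Presheaf`/`Scheme.Modules` are not reducible (as in Mathlib's `AlgebraicGeometry/Modules/Sheaf.lean`).
set_option backward.isDefEq.respectTransparency false

open CategoryTheory CategoryTheory.Limits AlgebraicGeometry Opposite TopologicalSpace
open AlgebraicGeometry.Scheme.Modules

universe u

namespace Literature.AlgebraicGeometry.HodgeTheory

open Literature.AlgebraicGeometry.Modules Literature.AlgebraicGeometry.Motives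

variable {S : Type u} [CommRing S] {X₀ X₁ : Over (Spec (CommRingCat.of S))} (g : X₀ ⟶ X₁)

/-! ## §1 The transpose `β_j : E ⊗ Ωʲ ⟶ g_*(g^*E ⊗ Ωʲ)` of `α_j` and its sections -/

section Transpose

variable {E : X₁.left.Modules} (hE : IsFiniteLocallyFree E) (j : ℕ)

/-- **`β_j : E ⊗ Ωʲ_{X₁} ⟶ g_*(g^*E ⊗ Ωʲ_{X₀})`** — the transpose of `α_j = twistHodgePullbackHom g hE j` under `g^* ⊣ g_*`
(unit followed by `g_* α_j`). [cite: Hartshorne1977, II §5 p. 110 and II Prop. 8.11] -/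
def twistHodgePullbackTransposeHom :
    twistHodge E j ⟶ (pushforward g.left).obj (twistHodge ((Scheme.Modules.pullback g.left).obj E) j) :=
  (pullbackPushforwardAdjunction g.left).unit.app (twistHodge E j) ≫ (pushforward g.left).map (twistHodgePullbackHom g hE j)

/-- `β_j` is the `homEquiv`-transpose of `α_j`. [cite: Hartshorne1977, II §5 p. 110] -/
theorem homEquiv_twistHodgePullbackHom :
    (pullbackPushforwardAdjunction g.left).homEquiv _ _ (twistHodgePullbackHom g hE j) = twistHodgePullbackTransposeHom g hE j :=
  (pullbackPushforwardAdjunction g.left).homEquiv_unit _ _ _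

/-- **The sections of `β_j` as local morphisms**: for `φ ∈ Γ(E ⊗ Ωʲ, V) = Hom(E^∨|_V, Ωʲ|_V)`,
`β_j(φ) = ((g^*E)^∨ ≅ g^*(E^∨))|_{g⁻¹V} ≫ g^*φ ≫ dg|_{g⁻¹V} : (g^*E)^∨|_{g⁻¹V} ⟶ Ωʲ_{X₀}|_{g⁻¹V}` (`g^*φ = pullbackHomOver g.left φ`).
[cite: Hartshorne1977, II Ex. 5.1 (b) and II Prop. 8.11] [cite: GortzWedhorn2020, (7.8.3)] -/
def twistHodgePullbackTransposeOver (V : X₁.left.Opens) (φ : (dual E).over V ⟶ (hodgeSheaf X₁ j).over V) :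
    (dual ((Scheme.Modules.pullback g.left).obj E)).over (g.left ⁻¹ᵁ V) ⟶ (hodgeSheaf X₀ j).over (g.left ⁻¹ᵁ V) :=
  (SheafOfModules.overFunctor _ (g.left ⁻¹ᵁ V)).map (pullbackDualIso g.left hE).inv ≫ pullbackHomOver g.left φ ≫
    (SheafOfModules.overFunctor _ (g.left ⁻¹ᵁ V)).map (pullbackForms g j)

/-- **Sections of `β_j`**: `β_j(φ) = twistHodgePullbackTransposeOver g hE j V φ`.
[cite: Hartshorne1977, II Ex. 5.1 (b) and II Prop. 8.11] [cite: GortzWedhorn2020, (7.8.3)] -/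
theorem twistHodgePullbackTransposeHom_app (V : X₁.left.Opens) (φ : (dual E).over V ⟶ (hodgeSheaf X₁ j).over V) :
    (twistHodgePullbackTransposeHom g hE j).app V φ = twistHodgePullbackTransposeOver g hE j V φ := by
  change (twistHodgePullbackHom g hE j).app (g.left ⁻¹ᵁ V) (unitSection g.left (twistHodge E j) V φ) = _
  rw [twistHodgePullbackHom, pullbackTwistComparison, Scheme.Modules.Hom.comp_app, Scheme.Modules.Hom.comp_app,
    ConcreteCategory.comp_apply, ConcreteCategory.comp_apply, app_sheafHomPullbackComparison_unitSection,
    sheafHomMapLeft_app_apply, sheafHomMap_app_apply, Category.assoc]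
  rfl

/-- `β_j` is `g♯`-semilinear on sections: `β_j(a • φ) = g♯(a) • β_j(φ)` (the `𝒪_{X₁}`-module structure of a direct image).
[cite: Hartshorne1977, II §5 p. 110] -/
theorem twistHodgePullbackTransposeOver_smul (V : X₁.left.Opens) (a : Γ(X₁.left, V))
    (φ : (dual E).over V ⟶ (hodgeSheaf X₁ j).over V) :
    twistHodgePullbackTransposeOver g hE j V (a • φ) = g.left.app V a • twistHodgePullbackTransposeOver g hE j V φ := by
  rw [← twistHodgePullbackTransposeHom_app, ← twistHodgePullbackTransposeHom_app, Scheme.Modules.Hom.app_smul]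
  rfl

/-- `β_j` is additive on sections. [cite: Hartshorne1977, II §5 p. 110] -/
theorem twistHodgePullbackTransposeOver_add (V : X₁.left.Opens) (φ ψ : (dual E).over V ⟶ (hodgeSheaf X₁ j).over V) :
    twistHodgePullbackTransposeOver g hE j V (φ + ψ) =
      twistHodgePullbackTransposeOver g hE j V φ + twistHodgePullbackTransposeOver g hE j V ψ := by
  simp only [twistHodgePullbackTransposeOver, pullbackHomOver_add, Preadditive.add_comp, Preadditive.comp_add]

/-- `β_j(0) = 0`. [cite: Hartshorne1977, II §5 p. 110] -/
theorem twistHodgePullbackTransposeOver_zero (V : X₁.left.Opens) :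
    twistHodgePullbackTransposeOver g hE j V (0 : (dual E).over V ⟶ (hodgeSheaf X₁ j).over V) = 0 := by
  simp only [twistHodgePullbackTransposeOver, pullbackHomOver_zero, zero_comp, comp_zero]

/-- `β_j` commutes with restriction: `β_j(φ)|_{g⁻¹V'} = β_j(φ|_{V'})`. [cite: Hartshorne1977, II §5 p. 110] -/
theorem restrictHom_twistHodgePullbackTransposeOver {V V' : X₁.left.Opens} (i : V' ⟶ V)
    (φ : (dual E).over V ⟶ (hodgeSheaf X₁ j).over V) :
    restrictHom ((Opens.map g.left.base).map i) (twistHodgePullbackTransposeOver g hE j V φ) =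
      twistHodgePullbackTransposeOver g hE j V' (restrictHom i φ) := by
  rw [twistHodgePullbackTransposeOver, twistHodgePullbackTransposeOver, restrictHom_comp, restrictHom_comp, restrictHom_over_map,
    restrictHom_over_map, restrictHom_pullbackHomOver]

end Transpose

/-! ## §2 The twisting term `da ∧ –` along `g` -/

section Wedge

variable (j : ℕ)

/-- **The twisting term along `g^*`, as morphisms out of `(g^*Ωʲ_{X₁})|_{g⁻¹V}`**: for `a ∈ Γ(X₁, V)`,
`g^*(∧|_V ≫ ev_{da}) ≫ dg_{j+1}|_{g⁻¹V} = dg_j|_{g⁻¹V} ≫ ∧'|_{g⁻¹V} ≫ ev_{d(g♯a)}` — on pulled-back sections `η(ω)` this is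
`g♯(da ∧ ω) = d(g♯a) ∧ g♯ω` (the tree's `wedge_evalAt_dSection_comap`, any `g`).
[cite: Hartshorne1977, II Prop. 8.11 and II Ex. 5.16 (e) (pull-back of forms is multiplicative and commutes with d)] -/
theorem pullbackHomOver_wedge_evalAt_comp_pullbackForms (V : X₁.left.Opens) (a : Γ(X₁.left, V)) :
    pullbackHomOver g.left ((SheafOfModules.overFunctor _ V).map (wedgeSheafHom X₁ j) ≫
        evalAt (M := hodgeSheaf X₁ (j + 1)) (dSection X₁ V a)) ≫
        (SheafOfModules.overFunctor _ (g.left ⁻¹ᵁ V)).map (pullbackForms g (j + 1)) =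
      (SheafOfModules.overFunctor _ (g.left ⁻¹ᵁ V)).map (pullbackForms g j) ≫
        (SheafOfModules.overFunctor _ (g.left ⁻¹ᵁ V)).map (wedgeSheafHom X₀ j) ≫
          evalAt (M := hodgeSheaf X₀ (j + 1)) (dSection X₀ (g.left ⁻¹ᵁ V) (g.left.app V a)) := by
  refine hom_ext_of_appLE_unitSection g.left fun W k ω => ?_
  have h := congrArg (fun θ => appLE θ k ω) (wedge_evalAt_dSection_comap g j V a)
  simp only [appLE_comp, appLE_over_map, appLE_pushforwardOverHom, appLE_evalAt, map_dSection, pushforward_map_app] at h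
  simp only [appLE_comp, appLE_over_map, appLE_pullbackHomOver_unitSection, pullbackForms_app_unitSection, appLE_evalAt,
    map_dSection]
  exact h

variable {E : X₁.left.Modules} (hE : IsFiniteLocallyFree E)

/-- **The twisting terms correspond under `β`**: `β_{j+1}(D_{X₁}(a, φ)) = D_{X₀}(g♯a, β_j φ)`, i.e. `β_{j+1}(da ∧ φ) = d(g♯a) ∧ β_j(φ)`.
[cite: BuchweitzFlenner2003, §3 (Atiyah class; its functoriality under base change)] [cite: Hartshorne1977, II Prop. 8.11] -/
theorem twistHodgePullbackTransposeOver_wedgeD (V : X₁.left.Opens) (a : Γ(X₁.left, V))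
    (φ : (dual E).over V ⟶ (hodgeSheaf X₁ j).over V) :
    twistHodgePullbackTransposeOver g hE (j + 1) V (wedgeD E j V a φ) =
      wedgeD ((Scheme.Modules.pullback g.left).obj E) j (g.left ⁻¹ᵁ V) (g.left.app V a)
        (twistHodgePullbackTransposeOver g hE j V φ) := by
  rw [twistHodgePullbackTransposeOver, twistHodgePullbackTransposeOver, wedgeD, wedgeD, pullbackHomOver_comp]
  simp only [Category.assoc]
  rw [pullbackHomOver_wedge_evalAt_comp_pullbackForms]

/-- The second components match under the twisted actions (linearity of `(φ, ψ) ↦ (β_j φ, β_{j+1} ψ)` into the direct image).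
[cite: BuchweitzFlenner2003, §3 (Atiyah class; its functoriality under base change)] -/
theorem twistHodgePullbackTransposeOver_snd_smul (V : X₁.left.Opens) (a : Γ(X₁.left, V)) (p : TwistJetSections E j V) :
    twistHodgePullbackTransposeOver g hE (j + 1) V ((a • p).snd) =
      (g.left.app V a • (TwistJetSections.mk (twistHodgePullbackTransposeOver g hE j V p.fst)
        (twistHodgePullbackTransposeOver g hE (j + 1) V p.snd) :
          TwistJetSections ((Scheme.Modules.pullback g.left).obj E) j (g.left ⁻¹ᵁ V))).snd := by
  rw [TwistJetSections.snd_smul, TwistJetSections.snd_smul, TwistJetSections.fst_mk, TwistJetSections.snd_mk,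
    twistHodgePullbackTransposeOver_add, twistHodgePullbackTransposeOver_smul, twistHodgePullbackTransposeOver_wedgeD]

end Wedge

/-! ## §3 The base-change morphism of the twisted jet modules -/

section Jet

variable {E : X₁.left.Modules} (hE : IsFiniteLocallyFree E) (j : ℕ)

/-- **`Pʲ(E) ⟶ g_* Pʲ(g^*E)` on sections: `(φ, ψ) ↦ (β_j φ, β_{j+1} ψ)`**, `𝒪_{X₁}`-linear for the twisted structures by
`twistHodgePullbackTransposeOver_snd_smul`. [cite: Atiyah1957, §4 Prop. 6–7 (functoriality of the jet extension)]
[cite: BuchweitzFlenner2003, §3 (Atiyah class; base change)] -/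
def twistJetPullbackTransposeHom :
    twistJetModule E j ⟶ (pushforward g.left).obj (twistJetModule ((Scheme.Modules.pullback g.left).obj E) j) where
  val := PresheafOfModules.homMk
    { app := fun V => AddCommGrpCat.ofHom
        { toFun := fun p : TwistJetSections E j V.unop =>
            (TwistJetSections.mk (twistHodgePullbackTransposeOver g hE j V.unop p.fst)
              (twistHodgePullbackTransposeOver g hE (j + 1) V.unop p.snd) :
                TwistJetSections ((Scheme.Modules.pullback g.left).obj E) j (g.left ⁻¹ᵁ V.unop))
          map_zero' := TwistJetSections.ext (twistHodgePullbackTransposeOver_zero g hE j V.unop)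
            (twistHodgePullbackTransposeOver_zero g hE (j + 1) V.unop)
          map_add' := fun p q => TwistJetSections.ext (twistHodgePullbackTransposeOver_add g hE j V.unop p.fst q.fst)
            (twistHodgePullbackTransposeOver_add g hE (j + 1) V.unop p.snd q.snd) }
      naturality := fun {V _} i =>
        AddCommGrpCat.ext fun (p : TwistJetSections E j V.unop) => TwistJetSections.ext
          (restrictHom_twistHodgePullbackTransposeOver g hE j i.unop p.fst).symm
          (restrictHom_twistHodgePullbackTransposeOver g hE (j + 1) i.unop p.snd).symm }
    (fun V (a : Γ(X₁.left, V.unop)) (p : TwistJetSections E j V.unop) => TwistJetSections.ext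
      (twistHodgePullbackTransposeOver_smul g hE j V.unop a p.fst)
      (twistHodgePullbackTransposeOver_snd_smul g j hE V.unop a p))

/-- Sections of `twistJetPullbackTransposeHom`. [cite: Atiyah1957, §4 Prop. 6–7 (functoriality of the jet extension)] -/
@[simp]
theorem twistJetPullbackTransposeHom_app_apply (V : X₁.left.Opens) (p : TwistJetSections E j V) :
    (twistJetPullbackTransposeHom g hE j).app V p =
      (TwistJetSections.mk (twistHodgePullbackTransposeOver g hE j V p.fst)
        (twistHodgePullbackTransposeOver g hE (j + 1) V p.snd) :
          TwistJetSections ((Scheme.Modules.pullback g.left).obj E) j (g.left ⁻¹ᵁ V)) := rfl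

/-- **THE BASE-CHANGE MORPHISM OF THE TWISTED JET MODULES `g^* Pʲ(E) ⟶ Pʲ(g^*E)`** for ANY morphism `g` of `S`-schemes and `E`
finite locally free — the transpose of `(φ, ψ) ↦ (β_j φ, β_{j+1} ψ)` under `g^* ⊣ g_*` («jets commute with base change»; an isomorphism for
`g` étale — not proved here). [cite: Atiyah1957, §4 Prop. 6–7 (functoriality of the jet extension)]
[cite: BuchweitzFlenner2003, §3 (Atiyah class; base change)] [cite: Hartshorne1977, II §5 p. 110] -/
def twistJetPullbackHom :
    (Scheme.Modules.pullback g.left).obj (twistJetModule E j) ⟶ twistJetModule ((Scheme.Modules.pullback g.left).obj E) j :=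
  ((pullbackPushforwardAdjunction g.left).homEquiv _ _).symm (twistJetPullbackTransposeHom g hE j)

/-- The transpose of `twistJetPullbackHom` is `twistJetPullbackTransposeHom`. [cite: Hartshorne1977, II §5 p. 110] -/
theorem homEquiv_twistJetPullbackHom :
    (pullbackPushforwardAdjunction g.left).homEquiv _ _ (twistJetPullbackHom g hE j) = twistJetPullbackTransposeHom g hE j := by
  simp only [twistJetPullbackHom, Equiv.apply_symm_apply]

/-! ## §4 Compatibility with `ι` and `π`: the morphism of twisted Atiyah sequences -/

/-- Transposed form: `ι ≫ (Pʲ(E) → g_*Pʲ(g^*E)) = β_{j+1} ≫ g_*(ι')` (`(0, ψ) ↦ (β_j 0, β_{j+1} ψ) = (0, β_{j+1} ψ)`).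
[cite: BuchweitzFlenner2003, §3 (Atiyah class; base change)] -/
theorem twistJetι_comp_twistJetPullbackTransposeHom :
    twistJetι E j ≫ twistJetPullbackTransposeHom g hE j =
      twistHodgePullbackTransposeHom g hE (j + 1) ≫
        (pushforward g.left).map (twistJetι ((Scheme.Modules.pullback g.left).obj E) j) := by
  refine Scheme.Modules.hom_ext _ _ fun V => AddCommGrpCat.ext
    fun (ψ : (dual E).over V ⟶ (hodgeSheaf X₁ (j + 1)).over V) => ?_
  exact TwistJetSections.ext (twistHodgePullbackTransposeOver_zero g hE j V)
    (twistHodgePullbackTransposeHom_app g hE (j + 1) V ψ).symm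

/-- Transposed form: `(Pʲ(E) → g_*Pʲ(g^*E)) ≫ g_*(π') = π ≫ β_j`. [cite: BuchweitzFlenner2003, §3 (Atiyah class; base change)] -/
theorem twistJetPullbackTransposeHom_comp_map_twistJetπ :
    twistJetPullbackTransposeHom g hE j ≫ (pushforward g.left).map (twistJetπ ((Scheme.Modules.pullback g.left).obj E) j) =
      twistJetπ E j ≫ twistHodgePullbackTransposeHom g hE j :=
  Scheme.Modules.hom_ext _ _ fun V => AddCommGrpCat.ext fun (p : TwistJetSections E j V) =>
    (twistHodgePullbackTransposeHom_app g hE j V p.fst).symm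

/-- **Compatibility with the inclusions**: `g^*(ι) ≫ (g^*Pʲ(E) → Pʲ(g^*E)) = α_{j+1} ≫ ι'`.
[cite: BuchweitzFlenner2003, §3 (Atiyah class; base change)] [cite: Atiyah1957, §4 Prop. 6–7] -/
theorem pullback_map_twistJetι_comp_twistJetPullbackHom :
    (Scheme.Modules.pullback g.left).map (twistJetι E j) ≫ twistJetPullbackHom g hE j =
      twistHodgePullbackHom g hE (j + 1) ≫ twistJetι ((Scheme.Modules.pullback g.left).obj E) j := by
  apply ((pullbackPushforwardAdjunction g.left).homEquiv _ _).injective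
  rw [Adjunction.homEquiv_naturality_left, Adjunction.homEquiv_naturality_right, homEquiv_twistJetPullbackHom,
    homEquiv_twistHodgePullbackHom, twistJetι_comp_twistJetPullbackTransposeHom]

/-- **Compatibility with the projections**: `g^*(π) ≫ α_j = (g^*Pʲ(E) → Pʲ(g^*E)) ≫ π'`.
[cite: BuchweitzFlenner2003, §3 (Atiyah class; base change)] [cite: Atiyah1957, §4 Prop. 6–7] -/
theorem pullback_map_twistJetπ_comp_twistHodgePullbackHom :
    (Scheme.Modules.pullback g.left).map (twistJetπ E j) ≫ twistHodgePullbackHom g hE j =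
      twistJetPullbackHom g hE j ≫ twistJetπ ((Scheme.Modules.pullback g.left).obj E) j := by
  apply ((pullbackPushforwardAdjunction g.left).homEquiv _ _).injective
  rw [Adjunction.homEquiv_naturality_left, Adjunction.homEquiv_naturality_right, homEquiv_twistJetPullbackHom,
    homEquiv_twistHodgePullbackHom, twistJetPullbackTransposeHom_comp_map_twistJetπ]

/-- **The morphism of twisted Atiyah sequences along `g^*`**:
`g^*(0 → E ⊗ Ωʲ⁺¹ → Pʲ(E) → E ⊗ Ωʲ → 0) ⟶ (0 → g^*E ⊗ Ωʲ⁺¹ → Pʲ(g^*E) → g^*E ⊗ Ωʲ → 0)` with components `α_{j+1}`, the jet comparison,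
`α_j`. [cite: BuchweitzFlenner2003, §3 (Atiyah class; base change)] [cite: Atiyah1957, §4 Prop. 6–7] -/
def twistJetShortComplexPullbackHom :
    (twistJetShortComplex E j).map (Scheme.Modules.pullback g.left) ⟶
      twistJetShortComplex ((Scheme.Modules.pullback g.left).obj E) j where
  τ₁ := twistHodgePullbackHom g hE (j + 1)
  τ₂ := twistJetPullbackHom g hE j
  τ₃ := twistHodgePullbackHom g hE j
  comm₁₂ := (pullback_map_twistJetι_comp_twistJetPullbackHom g hE j).symm
  comm₂₃ := (pullback_map_twistJetπ_comp_twistHodgePullbackHom g hE j).symm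

/-- Components of `twistJetShortComplexPullbackHom` (definitional). [cite: BuchweitzFlenner2003, §3 (Atiyah class; base change)] -/
theorem twistJetShortComplexPullbackHom_τ :
    (twistJetShortComplexPullbackHom g hE j).τ₁ = twistHodgePullbackHom g hE (j + 1) ∧
      (twistJetShortComplexPullbackHom g hE j).τ₂ = twistJetPullbackHom g hE j ∧
        (twistJetShortComplexPullbackHom g hE j).τ₃ = twistHodgePullbackHom g hE j :=
  ⟨rfl, rfl, rfl⟩

end Jet

/-! ## §5 `ι : E → E ⊗ Ω⁰` along `g^*` -/

section Iota

/-- **Pull-back of `0`-forms is `g♯` on functions**, sections form: `g^♯((𝒪 ≅ Ω⁰)⁻¹ a) = (𝒪 ≅ Ω⁰)⁻¹ (g♯a)` for `a ∈ Γ(X₁, W)`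
(any morphism `g` of `S`-schemes). [cite: Hartshorne1977, II Prop. 8.11 (on 0-forms the pull-back of forms is g♯)] -/
theorem comap_app_hodgeSheafZeroIso_inv_app (W : X₁.left.Opens) (a : Γ(X₁.left, W)) :
    (hodgeSheaf.comap g 0).app W ((hodgeSheafZeroIso X₁).inv.app W a) =
      (hodgeSheafZeroIso X₀).inv.app (g.left ⁻¹ᵁ W) (g.left.app W a) := by
  rw [hodgeSheafZeroIso_inv_app, hodgeSheafZeroIso_inv_app]
  erw [exteriorPower_iso₀_inv_apply, exteriorPower_iso₀_inv_apply, hodgeSheaf.comap_app_toHodgeSheaf,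
    comapWedge_smul, comapWedge_mk]
  congr 2

/-- The same for `dg` on `0`-forms in pull-back form: `dg₀(η((𝒪 ≅ Ω⁰)⁻¹ a)) = (𝒪 ≅ Ω⁰)⁻¹(g♯a)`.
[cite: Hartshorne1977, II Prop. 8.11 (on 0-forms the pull-back of forms is g♯)] -/
theorem pullbackForms_app_unitSection_hodgeSheafZeroIso_inv (W : X₁.left.Opens) (a : Γ(X₁.left, W)) :
    (pullbackForms g 0).app (g.left ⁻¹ᵁ W) (unitSection g.left (hodgeSheaf X₁ 0) W ((hodgeSheafZeroIso X₁).inv.app W a)) =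
      (hodgeSheafZeroIso X₀).inv.app (g.left ⁻¹ᵁ W) (g.left.app W a) := by
  rw [pullbackForms_app_unitSection, comap_app_hodgeSheafZeroIso_inv_app]

variable {E : X₁.left.Modules} (hE : IsFiniteLocallyFree E)

/-- **`ι : E → E ⊗ Ω⁰` along `g^*`**: `g^*(ι_E) ≫ α_0 = ι_{g^*E}` (`ι = toTwistHodgeZero`: biduality then `𝒪 ≅ Ω⁰`). Transposed and
precomposed with `(g^*E)^∨ ≅ g^*(E^∨)`, both sides send `s ∈ Γ(E, V)` and a pulled-back functional `η(μ)`, `μ ∈ Γ(E^∨, W)`, to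
`(𝒪 ≅ Ω⁰)⁻¹(g♯(μ(s)))`. [cite: Hartshorne1977, II Ex. 5.1 (a), (b) and II Prop. 8.11] [cite: BuchweitzFlenner2003, §3 (base change)] -/
theorem pullback_map_toTwistHodgeZero_comp_twistHodgePullbackHom :
    (Scheme.Modules.pullback g.left).map (toTwistHodgeZero E) ≫ twistHodgePullbackHom g hE 0 =
      toTwistHodgeZero ((Scheme.Modules.pullback g.left).obj E) := by
  apply ((pullbackPushforwardAdjunction g.left).homEquiv _ _).injective
  rw [Adjunction.homEquiv_naturality_left, homEquiv_twistHodgePullbackHom, Adjunction.homEquiv_unit]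
  refine Scheme.Modules.hom_ext _ _ fun V => AddCommGrpCat.ext fun (s : Γ(E, V)) => ?_
  rw [Scheme.Modules.Hom.comp_app, Scheme.Modules.Hom.comp_app, ConcreteCategory.comp_apply, ConcreteCategory.comp_apply,
    pushforward_map_app, twistHodgePullbackTransposeHom_app]
  change twistHodgePullbackTransposeOver g hE 0 V ((toTwistHodgeZero E).app V s) =
    (toTwistHodgeZero ((Scheme.Modules.pullback g.left).obj E)).app (g.left ⁻¹ᵁ V) (unitSection g.left E V s)
  rw [twistHodgePullbackTransposeOver, toTwistHodgeZero, toTwistHodgeZero, Scheme.Modules.Hom.comp_app,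
    Scheme.Modules.Hom.comp_app, ConcreteCategory.comp_apply, ConcreteCategory.comp_apply, toBidual_app_apply, toBidual_app_apply,
    sheafHomMap_app_apply, sheafHomMap_app_apply, ← Functor.mapIso_inv, Iso.inv_comp_eq, Functor.mapIso_hom]
  refine hom_ext_of_appLE_unitSection g.left fun W k μ => ?_
  simp only [appLE_comp, appLE_over_map, appLE_pullbackHomOver_unitSection, appLE_evalAt,
    pullbackForms_app_unitSection_hodgeSheafZeroIso_inv, pullbackDualIso_hom]
  rw [pullbackDualComparison, Scheme.Modules.Hom.comp_app, ConcreteCategory.comp_apply, app_sheafHomPullbackComparison_unitSection,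
    sheafHomMap_app_apply, appLE_comp, appLE_over_map, ← unitSection_map,
    appLE_congr_hom (pullbackHomOver g.left μ) (𝟙 _) ((Opens.map g.left.base).map (𝟙 W)), appLE_pullbackHomOver_unitSection,
    app_pullbackUnitComparison_unitSection]

end Iota

end Literature.AlgebraicGeometry.HodgeTheory

end
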